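import Summits.BirchSwinnertonDyer.BirchSwinnertonDyer.Theorems.KatoDescentPotSupersingularKatoFiniteLevelStrictCompactMap
import Summits.BirchSwinnertonDyer.BirchSwinnertonDyer.Theorems.KatoDescentPotSupersingularUnramifiedLocalConditionSelfDual
import Summits.BirchSwinnertonDyer.BirchSwinnertonDyer.Theorems.SmallImageMuTransferMuTransferX9StepFourReciprocity
import HarnessLib

/-!
# Reciprocity isotropy: global classes UNRAMIFIED OUTSIDE `P` have `∑_{v ∈ P} ⟨x_v, y_v⟩_v = 0`, for EVERY finite module (ramified or not);
# over `ℚ` with `P = {v_p}`: `⟨loc_p x, loc_p g_* red_{p^k}(a)⟩_p = 0` for `x` unramified off `p` and `a ∈ H¹(ℤ[1/p], T_pE)`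
# (route `KatoDescentPotSupersingular` / `…Tame…`, crux M = stmt-BirchSwinnertonDyer-19196; route-free helper)

Seat `bsd-potss-rkm` g18 (prover; cell `bsd-potss`), item stmt-BirchSwinnertonDyer-19196 (`--supports … --as helper`; closes
nothing).  HONEST FRAMING: BSD is not proved by any of this; nothing is booked; theorems only (no definition, no named fact):
TOOL theorems of global Galois cohomology.

## Why (brick (a) of crux M's level-0 ledger, step L3 of memo `HOME/rkm/FINDING-19196-rkm-g18.md` §ARCHITECTURE)

The sharp S-side count `#S(E[p^∞]) ≤ #Sel_str^{ur} · p^K/#im_K(A)` confines `loc_p` of a finite-level lift `c' ∈ H¹(ℚ, E[p^K])` of a class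
of Kato's `S` (Kummer at `p`, UNRAMIFIED at every `ℓ ≠ p` — the bad primes included, where `E[p^K]` is a RAMIFIED module) to the annihilator
of `B_K = loc_p red_{p^K}(A)`, `A = H¹(ℤ[1/p], T_pE)`.  That is Poitou–Tate reciprocity: `∑_v ⟨c'_v, (red a)_v⟩_v = 0`, the terms at
`ℓ ≠ p` vanish because BOTH classes are unramified there — for an ARBITRARY finite module by seat g17's Milne I 2.6 without the
unramified-module hypothesis (`UnramifiedSelfDual.localTatePairingZMod_eq_zero_of_mem_unramifiedSubgroup`) — and the archimedean term
vanishes at odd level (`StepFour.localTerm_inl_eq_zero_of_odd`).  The tree's `StepFour.localTerm_inr_eq_zero_of_unramified_outside` is the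
same bookkeeping but REQUIRES inertia to act trivially on `M` off `S`; this file removes that hypothesis and sums over a finite set `P`.

* `sum_localTerm_inr_eq_zero_of_unramified_outside` — `K` any number field, `n` odd, `M` any finite discrete `n`-torsion `Γ_K`-module, `inv`
  any family with the Poitou–Tate vanishing `SumLocalTermEqZero` (a THEOREM for the canonical family, `PoitouTateNumberField`): if
  `x ∈ H¹(K,M)` and `y ∈ H¹(K,M^D)` are unramified at every finite `v ∉ P` then **`∑_{v∈P} ⟨x_v, y_v⟩_v = 0`**; `…_singleton`: `P = {v₀}`.
* `localization_ofTopSubgroup_reduceH1Pk_mem_unramifiedSubgroup` — `loc_v red_{p^k}(a)` is unramified at every `v ≠ v_p` for `a ∈ A`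
  (g17 part 17's incantation, isolated).
* **`localTerm_primePlace_eq_zero_of_unramified_of_mem_integralH1`** — over `ℚ`: for `x ∈ H¹(ℚ,E[p^k])` unramified at every `v ≠ v_p`,
  `a ∈ A`, and ANY equivariant `g : E[p^k] → E[p^k]^D` (e.g. the Weil transport `(e_{p^k})^♭`): **`⟨loc_p x, loc_p g_*(red_{p^k} a)⟩_p = 0`**;
  and the mirror form `localTerm_primePlace_eq_zero_of_mem_integralH1_of_unramified` with `red_{p^k} a` in the first slot.

References: J. S. Milne, *ADT* I Thm. 4.10 (b), Thm. 2.6 [MilneADT2006]; K. Kato, Astérisque 295, proof of Prop. 14.16 (pp. 244–245), §8.2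
[Kato2004Asterisque]; J.-P. Serre, *Galois Cohomology* II §5–6 [SerreGaloisCohomology1997].
-/

-- the summit and its single problem are both named `BirchSwinnertonDyer` (registry layout D-0017)
set_option linter.dupNamespace false
set_option autoImplicit false

noncomputable section

open scoped Classical ContRepresentation NumberField
open Function Field NumberField IsDedekindDomain
open Literature.NumberTheory.EllipticCurves Literature.NumberTheory.GaloisRepresentations
  Literature.NumberTheory.GaloisRepresentations.DiscreteGaloisModule Literature.NumberTheory.GaloisCohomology
open Literature.NumberTheory.EllipticCurves.Kato2004 Literature.NumberTheory.EllipticCurves.Kato2004.EulerSystemValues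
open WeierstrassCurve (geomTorsion)
open Summit.BirchSwinnertonDyer.BirchSwinnertonDyer.Rank1Residual
open Summit.BirchSwinnertonDyer.BirchSwinnertonDyer.Theorems

universe u

namespace Summit.BirchSwinnertonDyer.BirchSwinnertonDyer.Theorems.KatoFiniteLevelCount

/-! ## §1 Classes unramified outside `P` are mutually orthogonal over `P` (any number field, any finite module, odd level) -/

section Generic

variable {K : Type u} [Field K] [NumberField K] {M : Type u} [AddCommGroup M] [TopologicalSpace M] [DiscreteTopology M]
  [Finite M] {n : ℕ} [NeZero n]

/-- **Reciprocity isotropy over a finite set of places.**  `n` odd, `M` ANY finite discrete `n`-torsion `Γ_K`-module (ramified or not),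
`inv` a family of local invariant maps with the Poitou–Tate vanishing.  If `x ∈ H¹(K, M)` and `y ∈ H¹(K, M^D)` have UNRAMIFIED
localisations at every finite place `v ∉ P`, then **`∑_{v ∈ P} ⟨x_v, y_v⟩_v = 0`**: the local terms vanish at the infinite places
(`n` odd) and at every finite `v ∉ P` (unramified classes are orthogonal with NO hypothesis on the inertia action, g17's Milne I 2.6),
so the Poitou–Tate sum over `P` (read in `Place K`) is the whole sum. [cite: MilneADT2006, Ch. I, Thm. 4.10 (b) and Thm. 2.6] -/
theorem sum_localTerm_inr_eq_zero_of_unramified_outside (hn : Odd n) {inv : LocalInvariants K n}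
    (hPT : inv.SumLocalTermEqZero) (ρ : DiscreteGaloisModule K M) (hM : ∀ m : M, n • m = 0)
    (P : Finset (HeightOneSpectrum (𝓞 K))) (x : galoisCohomology ρ 1) (y : galoisCohomology (ρ.tateDual n) 1)
    (hx : ∀ v ∉ P, galoisCohomology.localization ρ (Sum.inr v) 1 x ∈ unramifiedSubgroup (GaloisRep.toLocal v ρ) 1)
    (hy : ∀ v ∉ P, galoisCohomology.localization (ρ.tateDual n) (Sum.inr v) 1 y ∈
      unramifiedSubgroup (GaloisRep.toLocal v (ρ.tateDual n)) 1) :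
    ∑ v ∈ P, inv.localTerm ρ (Sum.inr v) x y = 0 := by
  have h := hPT ρ hM x y (P.map Function.Embedding.inr) fun v hv => ?_
  · rwa [Finset.sum_map] at h
  rcases v with w | v
  · exact StepFour.localTerm_inl_eq_zero_of_odd inv ρ hn hM w x y
  · have hvP : v ∉ P := fun h' => hv (Finset.mem_map.mpr ⟨v, h', rfl⟩)
    rw [LocalInvariants.localTerm_apply, ← DiscreteGaloisModule.localTatePairingZMod_apply]
    exact UnramifiedSelfDual.localTatePairingZMod_eq_zero_of_mem_unramifiedSubgroup ρ n v (inv (Sum.inr v)) (hx v hvP)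
      (hy v hvP)

/-- **One place: `⟨x_{v₀}, y_{v₀}⟩_{v₀} = 0`** for `x`, `y` unramified at every finite `v ≠ v₀` (`n` odd, any finite module).
[cite: MilneADT2006, Ch. I, Thm. 4.10 (b) and Thm. 2.6] -/
theorem localTerm_inr_eq_zero_of_unramified_outside_singleton (hn : Odd n) {inv : LocalInvariants K n}
    (hPT : inv.SumLocalTermEqZero) (ρ : DiscreteGaloisModule K M) (hM : ∀ m : M, n • m = 0)
    (v₀ : HeightOneSpectrum (𝓞 K)) (x : galoisCohomology ρ 1) (y : galoisCohomology (ρ.tateDual n) 1)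
    (hx : ∀ v ≠ v₀, galoisCohomology.localization ρ (Sum.inr v) 1 x ∈ unramifiedSubgroup (GaloisRep.toLocal v ρ) 1)
    (hy : ∀ v ≠ v₀, galoisCohomology.localization (ρ.tateDual n) (Sum.inr v) 1 y ∈
      unramifiedSubgroup (GaloisRep.toLocal v (ρ.tateDual n)) 1) :
    inv.localTerm ρ (Sum.inr v₀) x y = 0 := by
  have h := sum_localTerm_inr_eq_zero_of_unramified_outside hn hPT ρ hM {v₀} x y
    (fun v hv => hx v fun h => hv (Finset.mem_singleton.mpr h)) (fun v hv => hy v fun h => hv (Finset.mem_singleton.mpr h))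
  rwa [Finset.sum_singleton] at h

end Generic

/-! ## §2 Over `ℚ` at `v_p`: classes unramified off `p` against reductions of `A = H¹(ℤ[1/p], T_pE)` -/

section Rat

variable (W : WeierstrassCurve ℚ) [W.IsElliptic] (p : ℕ) [Fact p.Prime] (k : ℕ) [ContinuousSMul ℤ_[p] (W.tateModule p)]

/-- **`loc_v red_{p^k}(a)` is unramified at every `v ≠ v_p` for `a ∈ A = H¹(ℤ[1/p], T_pE)`** (integrality survives reduction,
tree `reduceH1Pk_mem_integralH1`; an integral class is principal on the inertia groups above `ℓ ≠ p`,
`ofTopSubgroup_mem_unramifiedKer_of_mem_integralH1`; that is the unramified condition, X10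
`localization_mem_unramifiedSubgroup_iff_mem_unramifiedKer`) — g17 part 17's step, isolated. [cite: Kato2004Asterisque, §8.2 (p. 180) and §13.8 (p. 228)] -/
theorem localization_ofTopSubgroup_reduceH1Pk_mem_unramifiedSubgroup {c : H1 (tateRep W p) ⊤}
    (hc : c ∈ integralH1 (tateRep W p) p ⊤) {v : HeightOneSpectrum (𝓞 ℚ)} (hv : v ≠ primePlace p) :
    galoisCohomology.localization (W.torsionGaloisModule ((p : ℤ) ^ k)) (Sum.inr v) 1
        ((ofTopSubgroup (W.torsionGaloisModule ((p : ℤ) ^ k)).toTopRep 1).hom (reduceH1Pk W p k ⊤ c)) ∈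
      unramifiedSubgroup (GaloisRep.toLocal v (W.torsionGaloisModule ((p : ℤ) ^ k))) 1 :=
  (Summit.BirchSwinnertonDyer.Rank1Residual.X10.ResidualSelmerCompanions.localization_mem_unramifiedSubgroup_iff_mem_unramifiedKer W ((p : ℤ) ^ k) v _).mpr
    (ofTopSubgroup_mem_unramifiedKer_of_mem_integralH1 W p ((p : ℤ) ^ k) (reduceH1Pk_mem_integralH1 W p k ⊤ hc)
      (primesEquiv_ne_of_ne_primePlace p hv) (adicCompletionPrime_mem_primesAbove ℚ v))

variable [Finite (geomTorsion W ((p : ℤ) ^ k))] {n : ℕ} [NeZero n]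

/-- **`⟨loc_p x, loc_p g_*(red_{p^k} a)⟩_p = 0`** for every `x ∈ H¹(ℚ, E[p^k])` UNRAMIFIED at every `v ≠ v_p` (e.g. a finite-level lift of a
class of Kato's `S`), every `a ∈ A = H¹(ℤ[1/p], T_pE)`, every equivariant `g : E[p^k] → E[p^k]^D` (e.g. the Weil transport), every family
`inv` with the Poitou–Tate vanishing at an odd level `n` killing `E[p^k]` — step L3 of brick (a): `loc_p` of the lift is ANNIHILATED by
`B_k = loc_p g_* red_{p^k}(A)`. [cite: MilneADT2006, Ch. I, Thm. 4.10 (b) and Thm. 2.6] [cite: Kato2004Asterisque, proof of Prop. 14.16 (pp. 244–245)] -/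
theorem localTerm_primePlace_eq_zero_of_unramified_of_mem_integralH1 (hn : Odd n) {inv : LocalInvariants ℚ n}
    (hPT : inv.SumLocalTermEqZero) (hM : ∀ m : geomTorsion W ((p : ℤ) ^ k), n • m = 0)
    (g : (W.torsionGaloisModule ((p : ℤ) ^ k)).toContRepresentation →ⁱL
      ((W.torsionGaloisModule ((p : ℤ) ^ k)).tateDual n).toContRepresentation)
    {x : galoisCohomology (W.torsionGaloisModule ((p : ℤ) ^ k)) 1}
    (hx : ∀ v : HeightOneSpectrum (𝓞 ℚ), v ≠ primePlace p →
      galoisCohomology.localization (W.torsionGaloisModule ((p : ℤ) ^ k)) (Sum.inr v) 1 x ∈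
        unramifiedSubgroup (GaloisRep.toLocal v (W.torsionGaloisModule ((p : ℤ) ^ k))) 1)
    {c : H1 (tateRep W p) ⊤} (hc : c ∈ integralH1 (tateRep W p) p ⊤) :
    inv.localTerm (W.torsionGaloisModule ((p : ℤ) ^ k)) (Sum.inr (primePlace p)) x
      (galoisCohomology.map g 1 ((ofTopSubgroup (W.torsionGaloisModule ((p : ℤ) ^ k)).toTopRep 1).hom (reduceH1Pk W p k ⊤ c))) = 0 :=
  localTerm_inr_eq_zero_of_unramified_outside_singleton hn hPT _ hM (primePlace p) x _ hx fun v hv =>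
    StepFour.localization_map_mem_unramifiedSubgroup g v (localization_ofTopSubgroup_reduceH1Pk_mem_unramifiedSubgroup W p k hc hv)

/-- **Mirror form: `⟨loc_p red_{p^k}(a), loc_p y⟩_p = 0`** for `a ∈ A` and every `y ∈ H¹(ℚ, E[p^k]^D)` unramified at every `v ≠ v_p`.
[cite: MilneADT2006, Ch. I, Thm. 4.10 (b) and Thm. 2.6] [cite: Kato2004Asterisque, proof of Prop. 14.16 (pp. 244–245)] -/
theorem localTerm_primePlace_eq_zero_of_mem_integralH1_of_unramified (hn : Odd n) {inv : LocalInvariants ℚ n}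
    (hPT : inv.SumLocalTermEqZero) (hM : ∀ m : geomTorsion W ((p : ℤ) ^ k), n • m = 0)
    {c : H1 (tateRep W p) ⊤} (hc : c ∈ integralH1 (tateRep W p) p ⊤)
    {y : galoisCohomology ((W.torsionGaloisModule ((p : ℤ) ^ k)).tateDual n) 1}
    (hy : ∀ v : HeightOneSpectrum (𝓞 ℚ), v ≠ primePlace p →
      galoisCohomology.localization ((W.torsionGaloisModule ((p : ℤ) ^ k)).tateDual n) (Sum.inr v) 1 y ∈
        unramifiedSubgroup (GaloisRep.toLocal v ((W.torsionGaloisModule ((p : ℤ) ^ k)).tateDual n)) 1) :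
    inv.localTerm (W.torsionGaloisModule ((p : ℤ) ^ k)) (Sum.inr (primePlace p))
      ((ofTopSubgroup (W.torsionGaloisModule ((p : ℤ) ^ k)).toTopRep 1).hom (reduceH1Pk W p k ⊤ c)) y = 0 :=
  localTerm_inr_eq_zero_of_unramified_outside_singleton hn hPT _ hM (primePlace p) _ y
    (fun _ hv => localization_ofTopSubgroup_reduceH1Pk_mem_unramifiedSubgroup W p k hc hv) hy

end Rat

end Summit.BirchSwinnertonDyer.BirchSwinnertonDyer.Theorems.KatoFiniteLevelCount

end
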